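import Mathlib

/-!
# Venture HSemireg — FORMULA-N PER-PAIR (graded) COUNT FLOOR (th-6): `dim ker (Π_i f i) ≥ Σ_i (dim V i − dim W i)₊`

HONEST FRAMING. Part of the Lean index of the computation cell `pub-hsemireg` (seat p3; enclosure of the FORMULA-N kernel
assets of seats th-7 / th-6, ENCLOSURE-PLAN-p3.md — file 58, added by p3 gen 10 on 2026-08-23 because STRUCTURE.md cites the
scratch file).  Finite-dimensional LINEAR ALGEBRA over a field ONLY: no variety, no cohomology theory, no semiregularity map is
constructed here; nothing here says that HC / HC_CM / HC_AV holds; no Literature fact is declared or used.  The DICTIONARY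
(`V i = Ext²_w`, `W i = M_w`, the weight grading of `τ₂`, the n = 5 instance Z_QI_20) lives in theory/FORMULA-N.md PART A §3.10 (v)(g)
and STRUCTURE.md, and is NOT asserted in Lean.

th-6's PER-PAIR FLOOR (theory/th6/PerPairFloor.lean sha256/16 7206af55fe4398b4, th-6 g6, 21:43Z 2026-08-22; farm rc 0 · 0 warnings ·
0 sorries, axioms standard), VERBATIM up to the namespace (`HSemiregPerPairFloor` ↦ `Summit.Ventures.HSemireg.FormulaN.PerPairFloor`):
if a linear map is the direct product of components `f i : V i →ₗ[K] W i` (a graded map between graded finite-dimensional spaces),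
then `Σ_i (finrank V i − finrank W i) ≤ finrank ker (Π_i f i)` with truncated subtraction in `ℕ` (= the positive part):
`finrank_sub_le_finrank_ker` (one component, rank–nullity), `sum_finrank_sub_le_sum_finrank_ker`, `piMap` / `kerPiEquiv`
(the kernel of a product map is the product of the kernels), **`perPairFloor`**; plus th-6's n = 5 arithmetic `example`
(caps 8 = 2^{5−2} on ten pairs, cap 0 on the weight-forbidden part: floor 53).
-/

open Module

namespace Summit.Ventures.HSemireg.FormulaN.PerPairFloor

variable {K : Type*} [Field K]

/-- One component: `dim V − dim W ≤ dim ker f` (truncated subtraction), from rank–nullity and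
`dim range f ≤ dim W`. -/
theorem finrank_sub_le_finrank_ker {V W : Type*} [AddCommGroup V] [Module K V] [FiniteDimensional K V]
    [AddCommGroup W] [Module K W] [FiniteDimensional K W] (f : V →ₗ[K] W) :
    finrank K V - finrank K W ≤ finrank K (LinearMap.ker f) := by
  have h1 := LinearMap.finrank_range_add_finrank_ker f
  have h2 : finrank K (LinearMap.range f) ≤ finrank K W := Submodule.finrank_le _
  omega

/-- Graded (product) form: for a family of components the kernel dimensions add up to at least the
sum of the per-component count excesses. -/
theorem sum_finrank_sub_le_sum_finrank_ker {ι : Type*} (s : Finset ι) (V W : ι → Type*)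
    [∀ i, AddCommGroup (V i)] [∀ i, Module K (V i)] [∀ i, FiniteDimensional K (V i)]
    [∀ i, AddCommGroup (W i)] [∀ i, Module K (W i)] [∀ i, FiniteDimensional K (W i)]
    (f : ∀ i, V i →ₗ[K] W i) :
    ∑ i ∈ s, (finrank K (V i) - finrank K (W i)) ≤ ∑ i ∈ s, finrank K (LinearMap.ker (f i)) :=
  Finset.sum_le_sum fun i _ => finrank_sub_le_finrank_ker (f i)

/-- The product map of the components. -/
def piMap {ι : Type*} (V W : ι → Type*) [∀ i, AddCommGroup (V i)] [∀ i, Module K (V i)]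
    [∀ i, AddCommGroup (W i)] [∀ i, Module K (W i)] (f : ∀ i, V i →ₗ[K] W i) :
    (∀ i, V i) →ₗ[K] (∀ i, W i) :=
  LinearMap.pi fun i => (f i).comp (LinearMap.proj i)

/-- The kernel of the product map is (linearly equivalent to) the product of the kernels. -/
def kerPiEquiv {ι : Type*} (V W : ι → Type*) [∀ i, AddCommGroup (V i)] [∀ i, Module K (V i)]
    [∀ i, AddCommGroup (W i)] [∀ i, Module K (W i)] (f : ∀ i, V i →ₗ[K] W i) :
    LinearMap.ker (piMap V W f) ≃ₗ[K] (∀ i, LinearMap.ker (f i)) where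
  toFun v := fun i => ⟨v.1 i, by
    have hv := v.2
    simp only [piMap, LinearMap.mem_ker] at hv
    exact congrFun hv i⟩
  invFun u := ⟨fun i => (u i).1, by
    simp only [piMap, LinearMap.mem_ker]
    ext i
    simp [LinearMap.pi_apply]⟩
  map_add' _ _ := rfl
  map_smul' _ _ := rfl
  left_inv _ := rfl
  right_inv _ := rfl

/-- PER-PAIR COUNT FLOOR, graded form: `Σ_i (dim V i − dim W i)₊ ≤ dim ker (Π_i f i)`. -/
theorem perPairFloor {ι : Type*} [Fintype ι] (V W : ι → Type*)
    [∀ i, AddCommGroup (V i)] [∀ i, Module K (V i)] [∀ i, FiniteDimensional K (V i)]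
    [∀ i, AddCommGroup (W i)] [∀ i, Module K (W i)] [∀ i, FiniteDimensional K (W i)]
    (f : ∀ i, V i →ₗ[K] W i) :
    ∑ i, (finrank K (V i) - finrank K (W i)) ≤ finrank K (LinearMap.ker (piMap V W f)) := by
  rw [LinearEquiv.finrank_eq (kerPiEquiv V W f), Module.finrank_pi_fintype]
  exact sum_finrank_sub_le_sum_finrank_ker Finset.univ V W f

/-- n = 5 instance of the arithmetic: ten pairs with cap 8 = 2^{5-2} and the weight-forbidden part with
cap 0 — Z_QI_20's per-pair dimensions (16,16,7,4,2,13,18,13,18,6; wf 7) give floor 53 (THEOREM W: 120 − 80 = 40). -/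
example : ((16 - 8) + (16 - 8) + (7 - 8) + (4 - 8) + (2 - 8) + (13 - 8) + (18 - 8) + (13 - 8) + (18 - 8)
    + (6 - 8) + (7 - 0) : ℕ) = 53 := by decide

end Summit.Ventures.HSemireg.FormulaN.PerPairFloor
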